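import Mathlib
import HarnessLib

/-!
# Card H (`decorated-colength-law`), stubs H3/H3′: termination of chains under a stationary law
(crux stmt-ResolutionOfSingularities-15640 `WildQuotients.WildQuotientResolution`, line `Sketch`;
chain w45c R-lane, res-L1-w45c-idea-1's `Sketch-L1-idea-1.lean` v6 §H stubs `stub_grkChain_finite` (H3)
and `stub_grkChain_length_le` (H3′), in DEF-FREE generic form (the GRK vocabulary `GRK`/`DNode`/
`StationaryConfig`/`GRKLaw` lives in idea-1's sketch, not in the tree): named for an idle stub seat by
res-L1-w45c-plan-1 2026-08-27T09:38:47Z; [OURS · L1 W4.5c] — NOT a statement of any manuscript;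
replaces the role of no printed item. Prover res-L1-w45c-stub-2.)

Abstract shape of the GRK chain law: nodes `N` with a height `ip : N → ℕ` and a step relation
`law : N → N → Prop` such that
* (mono) `ip` never increases along a step;
* (stat) after an `ip`-STATIONARY step at positive height the next step drops strictly — for the GRK
  law: a stationary step lands in an `R` point or in a `G` point with `m̄ ≥ 2`, and neither can start a
  stationary step (`StationaryConfig` needs a `G` point with `m̄ = 1` or a `K` point);
* (zero) a step from height `0` lands in a node with no further step — for the GRK law: `R(0) → K(0)`
  and a `K` point at height `0` has no bad child.
THEN every chain `c 0 → c 1 → ⋯ → c L` has `L ≤ 2·ip(c 0) + 1` (`CardH.chain_length_le`), and there is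
no infinite chain (`CardH.not_exists_infinite_chain`). idea-1's `stub_grkChain_length_le` /
`stub_grkChain_finite` are these at `ip := DNode.ip`, `law := GRKLaw` (the three hypotheses are
one-line case analyses on `GRK`).
-/

-- single-problem summit: the doubled namespace component `ResolutionOfSingularities` is forced
set_option linter.dupNamespace false

namespace Summit.ResolutionOfSingularities.ResolutionOfSingularities.Theorems.WildQuotientResolution.CardH

variable {N : Type*} (ip : N → ℕ) (law : N → N → Prop)
  (hmono : ∀ P Q, law P Q → ip Q ≤ ip P)
  (hstat : ∀ P Q R, law P Q → law Q R → ip Q = ip P → 0 < ip P → ip R < ip Q)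
  (hzero : ∀ P Q R, law P Q → ip P = 0 → ¬ law Q R)

include hmono hstat hzero in
/-- **H3′ · explicit depth bound.** Under (mono), (stat), (zero) a chain of `L` steps from `c 0` has
`L ≤ 2·ip(c 0) + 1`: the height drops within every two consecutive steps while positive, and at most
one step happens at height `0`. [OURS · L1 W4.5c] [folklore] -/
theorem chain_length_le (c : ℕ → N) (L : ℕ) (h : ∀ n < L, law (c n) (c (n + 1))) :
    L ≤ 2 * ip (c 0) + 1 := by
  induction L using Nat.strong_induction_on generalizing c with
  | _ L ih =>
    match L with
    | 0 => exact Nat.zero_le _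
    | 1 => omega
    | L + 2 =>
      have h01 : law (c 0) (c 1) := h 0 (by omega)
      have h12 : law (c 1) (c 2) := h 1 (by omega)
      by_cases hz : ip (c 0) = 0
      · exact absurd h12 (hzero _ _ _ h01 hz)
      · have hle1 : ip (c 1) ≤ ip (c 0) := hmono _ _ h01
        by_cases hs : ip (c 1) = ip (c 0)
        · -- a stationary first step: the second step drops strictly
          have hlt : ip (c 2) < ip (c 1) := hstat _ _ _ h01 h12 hs (Nat.pos_of_ne_zero hz)
          have hL : L ≤ 2 * ip (c (0 + 2)) + 1 :=
            ih L (by omega) (fun n => c (n + 2)) fun n hn => h (n + 2) (by omega)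
          rw [Nat.zero_add] at hL
          omega
        · have hlt : ip (c 1) < ip (c 0) := lt_of_le_of_ne hle1 hs
          have hL : L + 1 ≤ 2 * ip (c (0 + 1)) + 1 :=
            ih (L + 1) (by omega) (fun n => c (n + 1)) fun n hn => h (n + 1) (by omega)
          rw [Nat.zero_add] at hL
          omega

include hmono hstat hzero in
/-- **H3 · no infinite chain** obeys a law with (mono), (stat), (zero). [OURS · L1 W4.5c] [folklore] -/
theorem not_exists_infinite_chain : ¬ ∃ c : ℕ → N, ∀ n, law (c n) (c (n + 1)) := by
  rintro ⟨c, hc⟩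
  have := chain_length_le ip law hmono hstat hzero c (2 * ip (c 0) + 2) fun n _ => hc n
  omega

end Summit.ResolutionOfSingularities.ResolutionOfSingularities.Theorems.WildQuotientResolution.CardH
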